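import Summits.Ventures.LatticeQCDFlow.Scaling.SectorExactMixing

/-!
HONEST FRAMING: exact (Metropolis-corrected) sampling algorithms for lattice gauge theory; figures
of merit are autocorrelation/cost numbers at stated couplings and volumes; no continuum-physics
claim.

# SectorExactWitness — THE GENERAL-`S` QUALITY-`p` INSTANCE: ANY FINITE STATE SPACE, ANY POSITIVE LAW `ν`, ANY SECTOR `A`; COLD LAWS `ν`,
# HOT LAW `ν` WITH THE SECTOR `A` STARVED BY THE FACTOR `p`, IDENTITY MAPS, IDLE COLD REPLICAS — SECTOR-EXACT WITH SECTOR-WEIGHT QUALITY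
# EXACTLY `p`, HENCE `t_mix(ε) ≤ ⌈((2t+h)/(th))·max{m/(pc), K+1}·log(2(1 + K(2t+h)/(2t))/ε)⌉` WHATEVER `|S|` AND `ν` (lean-2 GEN-30, ours)

Venture-side (OURS).  Cell `lqcd-flow` (pub-lqcd), unit `pub-lqcd-lean-2-g30`, 2026-08-28.  Chapter Q (item 1 for sector-exact maps on a general
`S`), file 8: the hypotheses of `Scaling/SectorExactMixing` discharged on an explicit family — the general-`S` analogue of chapter O's
two-point witness.  `S` finite, `ν > 0` a probability vector, `A ⊆ S` with `A` and `Aᶜ` non-empty, `0 < p ≤ 1`; cold laws `μ_k = ν`, hot law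
`μ_0(u) = ν(u)·w(u)/Z` with `w = p` on `A`, `1` off `A`, `Z = Σ ν·w = 1 − (1−p)ν(A)`; identity entry maps on any hub list; exact hot redraws;
idle cold replicas.  Then `μ_l(u) = c(u)·μ_0(u)` with `cin = Z/p`, `cout = Z`: sector-exact with `min{1, cin/cout, cout/cin} = p`, and one-sided
domination holds with constant `p` (`p·ν(u) ≤ μ_0(u)`) — a quality-`p` flow that is perfect inside each sector and starves one sector by `p`.

## What is proved

* `sectorWitness_basic` (positivity, normalisation, sector-exactness with `cin = Z/p`, `cout = Z`, both sectors charged, the kernels),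
  `sectorWitness_oneSided` (`p·μ_l(u) ≤ μ_0(u)`);
* **`sectorWitness_mixingTime_le`** — for every finite `S`, `ν`, `A`, `K`, hub list with multiplicities `≥ c ≥ 1`, `0 < t < 1`, `w_0 > 0`,
  `0 < p ≤ 1`: **`t_mix(ε) ≤ ⌈((2t+h)/(th·min{pc/m, 1/(K+1)}))·log(2(1 + K(2t+h)/(2t))/ε)⌉`** — the bound does not see `|S|`, `ν` or `ν(A)`.

Reading (no numerics implied): on `|S|` points with an arbitrarily rough landscape `ν` the persistent hub of a quality-`p` sector-exact flow
mixes from the worst start in `O((K + m/(pc))(1/t + 1/h) log(K/ε))` steps; chapter O's witness is the case `|S| = 2`, where the matching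
floor `Θ((K/p) log K)` was proved.  NOT CLAIMED: flows inexact within a sector; anything measured.  Literature grade (cell rule): OWN
EXAMPLE; nothing cited as a fact; no new bib keys.
-/

noncomputable section

open Finset Function
open Literature.Probability.MarkovChains

namespace Summit.Ventures.LatticeQCDFlow.Scaling

variable {S : Type*} [Fintype S] [DecidableEq S] {K m : ℕ} {w : Fin (K + 1) → ℝ} {t p Z : ℝ} {ν : S → ℝ}

section SectorWitness
variable (κ : Fin m → Fin K) (A : Finset S)

/-- **The instance satisfies every hypothesis of `Scaling/SectorExactMixing`:** positivity and normalisation of the laws, sector-exactness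
with `cin = Z/p`, `cout = Z`, both sectors charged, row-stochastic sector-confined stationary kernels, exact hot redraw. [ours] -/
theorem sectorWitness_basic (hν : ∀ u, 0 < ν u) (hν1 : ∑ u, ν u = 1) (hp0 : 0 < p) (hp1 : p ≤ 1) (hAne : A.Nonempty)
    (hAc : ∃ u, u ∉ A) (hZ : Z = ∑ u, ν u * (if u ∈ A then p else 1)) :
    0 < Z ∧ Z ≤ 1
    ∧ (∀ (k : Fin (K + 1)) (u : S), 0 < (fun (k : Fin (K + 1)) (u : S) =>
        if k = 0 then ν u * (if u ∈ A then p else 1) / Z else ν u) k u)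
    ∧ (∀ k : Fin (K + 1), ∑ u, (fun (k : Fin (K + 1)) (u : S) => if k = 0 then ν u * (if u ∈ A then p else 1) / Z else ν u) k u = 1)
    ∧ (∀ (r : Fin m) (u : S), (fun (k : Fin (K + 1)) (u : S) => if k = 0 then ν u * (if u ∈ A then p else 1) / Z else ν u)
          (κ r).succ ((fun _ : Fin m => Equiv.refl S) r u)
        = (if u ∈ A then (fun _ : Fin m => Z / p) r else (fun _ : Fin m => Z) r)
          * (fun (k : Fin (K + 1)) (u : S) => if k = 0 then ν u * (if u ∈ A then p else 1) / Z else ν u) 0 u)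
    ∧ (∀ (k : Fin (K + 1)) (b : Bool), 0 < ∑ u ∈ univ.filter (fun u => decide (u ∈ A) = b),
        (fun (k : Fin (K + 1)) (u : S) => if k = 0 then ν u * (if u ∈ A then p else 1) / Z else ν u) k u)
    ∧ (∀ k : Fin (K + 1), IsRowStochastic ((fun (k : Fin (K + 1)) (u v : S) =>
        if k = 0 then ν v * (if v ∈ A then p else 1) / Z else (if u = v then (1 : ℝ) else 0)) k))
    ∧ (∀ k : Fin (K + 1), k ≠ 0 → ∀ v, ∑ u, (fun (k : Fin (K + 1)) (u : S) =>
          if k = 0 then ν u * (if u ∈ A then p else 1) / Z else ν u) k u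
        * (fun (k : Fin (K + 1)) (u v : S) => if k = 0 then ν v * (if v ∈ A then p else 1) / Z else (if u = v then (1 : ℝ) else 0)) k u v
        = (fun (k : Fin (K + 1)) (u : S) => if k = 0 then ν u * (if u ∈ A then p else 1) / Z else ν u) k v)
    ∧ (∀ k : Fin (K + 1), k ≠ 0 → ∀ u v : S, ¬(u ∈ A ↔ v ∈ A) →
        (fun (k : Fin (K + 1)) (u v : S) => if k = 0 then ν v * (if v ∈ A then p else 1) / Z else (if u = v then (1 : ℝ) else 0)) k u v = 0) := by
  have hwpos : ∀ u : S, 0 < (if u ∈ A then p else (1 : ℝ)) := fun u => by split_ifs; exacts [hp0, one_pos]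
  have hwle : ∀ u : S, (if u ∈ A then p else (1 : ℝ)) ≤ 1 := fun u => by split_ifs; exacts [hp1, le_rfl]
  haveI : Nonempty S := ⟨hAne.choose⟩
  have hZ0 : 0 < Z := by rw [hZ]; exact Finset.sum_pos (fun u _ => mul_pos (hν u) (hwpos u)) univ_nonempty
  have hZ1 : Z ≤ 1 := by
    rw [hZ]
    calc ∑ u, ν u * (if u ∈ A then p else (1 : ℝ)) ≤ ∑ u, ν u := sum_le_sum fun u _ => mul_le_of_le_one_right (hν u).le (hwle u)
      _ = 1 := hν1
  have hpos : ∀ (k : Fin (K + 1)) (u : S), 0 < (fun (k : Fin (K + 1)) (u : S) =>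
      if k = 0 then ν u * (if u ∈ A then p else 1) / Z else ν u) k u := by
    intro k u; dsimp only; split_ifs
    · exact div_pos (mul_pos (hν u) hp0) hZ0
    · exact div_pos (by rw [mul_one]; exact hν u) hZ0
    · exact hν u
  refine ⟨hZ0, hZ1, hpos, fun k => ?_, fun r u => ?_, fun k b => ?_, fun k => ⟨fun u v => ?_, fun u => ?_⟩, fun k hk v => ?_,
    fun k hk u v huv => ?_⟩
  · dsimp only
    by_cases hk : k = 0
    · simp only [hk, if_true]
      rw [← Finset.sum_div, ← hZ, div_self hZ0.ne']
    · simp only [hk, if_false]; exact hν1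
  · dsimp only
    simp only [Fin.succ_ne_zero, if_false, if_true, Equiv.refl_apply]
    by_cases hu : u ∈ A
    · rw [if_pos hu, if_pos hu]; field_simp
    · rw [if_neg hu, if_neg hu]; field_simp
  · apply Finset.sum_pos (fun u _ => hpos k u)
    cases b
    · obtain ⟨u, hu⟩ := hAc
      exact ⟨u, Finset.mem_filter.mpr ⟨mem_univ _, by rw [decide_eq_false_iff_not]; exact hu⟩⟩
    · obtain ⟨u, hu⟩ := hAne
      exact ⟨u, Finset.mem_filter.mpr ⟨mem_univ _, decide_eq_true hu⟩⟩
  · dsimp only; split_ifs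
    · exact (div_pos (mul_pos (hν v) hp0) hZ0).le
    · exact (div_pos (by rw [mul_one]; exact hν v) hZ0).le
    · exact zero_le_one
    · exact le_rfl
  · dsimp only
    by_cases hk : k = 0
    · simp only [hk, if_true]
      rw [← Finset.sum_div, ← hZ, div_self hZ0.ne']
    · simp only [hk, if_false]
      rw [Finset.sum_ite_eq univ u, if_pos (mem_univ _)]
  · dsimp only
    simp only [hk, if_false]
    simp_rw [mul_ite, mul_one, mul_zero]
    rw [Finset.sum_ite_eq' univ v, if_pos (mem_univ _)]
  · dsimp only
    rw [if_neg hk, if_neg]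
    intro h; apply huv; rw [h]

/-- **One-sided domination with constant `p`:** `p·μ_l(u) ≤ μ_0(u)` on the instance. [ours] -/
theorem sectorWitness_oneSided (hν : ∀ u, 0 < ν u) (hν1 : ∑ u, ν u = 1) (hp0 : 0 < p) (hp1 : p ≤ 1) (hAne : A.Nonempty) (hAc : ∃ u, u ∉ A)
    (hZ : Z = ∑ u, ν u * (if u ∈ A then p else 1)) (r : Fin m) (u : S) :
    p * (fun (k : Fin (K + 1)) (u : S) => if k = 0 then ν u * (if u ∈ A then p else 1) / Z else ν u) (κ r).succ
        ((fun _ : Fin m => Equiv.refl S) r u)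
      ≤ (fun (k : Fin (K + 1)) (u : S) => if k = 0 then ν u * (if u ∈ A then p else 1) / Z else ν u) 0 u := by
  obtain ⟨hZ0, hZ1, -⟩ := sectorWitness_basic κ A (K := K) hν hν1 hp0 hp1 hAne hAc hZ
  dsimp only
  simp only [Fin.succ_ne_zero, if_false, if_true, Equiv.refl_apply]
  rw [le_div_iff₀ hZ0]
  have hνu := hν u
  split_ifs
  · nlinarith [mul_le_mul_of_nonneg_left hZ1 (mul_pos hνu hp0).le]
  · have hpZ : p * Z ≤ 1 := by nlinarith
    nlinarith [mul_le_mul_of_nonneg_left hpZ hνu.le]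

/-- **THE MIXING TIME OF THE GENERAL-`S` QUALITY-`p` INSTANCE:**
**`t_mix(ε) ≤ ⌈((2t+h)/(th·min{pc/m, 1/(K+1)}))·log(2(1 + K(2t+h)/(2t))/ε)⌉`** for every finite `S`, positive `ν`, sector `A` (`A`, `Aᶜ`
non-empty), `K`, hub list with multiplicities `≥ c ≥ 1`, `0 < t < 1`, `w_0 > 0`, `0 < p ≤ 1`, `0 < ε`. [ours] -/
theorem sectorWitness_mixingTime_le (hm : 1 ≤ m) (ht0 : 0 < t) (ht1 : t < 1) (hw0 : ∀ k, 0 ≤ w k) (hw00 : 0 < w 0) (hw1 : ∑ k, w k = 1)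
    (hν : ∀ u, 0 < ν u) (hν1 : ∑ u, ν u = 1) (hp0 : 0 < p) (hp1 : p ≤ 1) (hAne : A.Nonempty) (hAc : ∃ u, u ∉ A)
    (hZ : Z = ∑ u, ν u * (if u ∈ A then p else 1))
    {c : ℕ} (hc1 : 1 ≤ c) (hc : ∀ p' : Fin K, c ≤ (univ.filter (fun r : Fin m => κ r = p')).card) {ε : ℝ} (hε : 0 < ε) :
    mixingTime (fun y z : Fin (K + 1) → S =>
        t * ptGraphSwap (fun (k : Fin (K + 1)) (u : S) => if k = 0 then ν u * (if u ∈ A then p else 1) / Z else ν u)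
            (fun r : Fin m => (((0 : Fin (K + 1)), (κ r).succ) : Fin (K + 1) × Fin (K + 1))) (fun _ : Fin m => Equiv.refl S) y z
          + (1 - t) * prodKernel w (fun (k : Fin (K + 1)) (u v : S) =>
              if k = 0 then ν v * (if v ∈ A then p else 1) / Z else (if u = v then (1 : ℝ) else 0)) y z)
        (tensorFun (fun (k : Fin (K + 1)) (u : S) => if k = 0 then ν u * (if u ∈ A then p else 1) / Z else ν u)) ε
      ≤ ⌈1 / (t * ((1 - t) * w 0) / (2 * t + (1 - t) * w 0) * min (p * c / m) (1 / (K + 1)))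
          * Real.log (2 * (1 + K * (2 * t + (1 - t) * w 0) / (2 * t)) / ε)⌉₊ := by
  obtain ⟨hZ0, hZ1, hμ, hμ1, hexact, hA, hM, hstat, hconf⟩ := sectorWitness_basic κ A (K := K) hν hν1 hp0 hp1 hAne hAc hZ
  have hφA : ∀ (r : Fin m) (u : S), (fun _ : Fin m => Equiv.refl S) r u ∈ A ↔ u ∈ A := fun r u => Iff.rfl
  have hcin : ∀ r : Fin m, 0 < (fun _ : Fin m => Z / p) r := fun _ => div_pos hZ0 hp0
  have hcout : ∀ r : Fin m, 0 < (fun _ : Fin m => Z) r := fun _ => hZ0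
  have hM0 : ∀ u v : S, (fun (k : Fin (K + 1)) (u v : S) =>
      if k = 0 then ν v * (if v ∈ A then p else 1) / Z else (if u = v then (1 : ℝ) else 0)) 0 u v
      = (fun (k : Fin (K + 1)) (u : S) => if k = 0 then ν u * (if u ∈ A then p else 1) / Z else ν u) 0 v := by
    intro u v; simp only [if_true]
  have ha : ∀ r : Fin m, p ≤ min 1 (min ((fun _ : Fin m => Z / p) r / (fun _ : Fin m => Z) r) ((fun _ : Fin m => Z) r / (fun _ : Fin m => Z / p) r)) := by
    intro r; dsimp only
    have h1 : Z / p / Z = 1 / p := by field_simp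
    have h2 : Z / (Z / p) = p := by field_simp
    rw [h1, h2]
    refine le_min hp1 (le_min ?_ le_rfl)
    rw [le_div_iff₀ hp0]; nlinarith
  exact sectorExact_mixingTime_le κ (fun _ : Fin m => Equiv.refl S) A hm ht0 ht1 hw0 hw00 hw1 hμ hμ1 hφA hcin hcout hexact hM hM0 hstat hconf
    hA hp0 ha hc1 hc hε

end SectorWitness

end Summit.Ventures.LatticeQCDFlow.Scaling

end
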